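import Literature.Claims.NS.ClayVariants
import Literature.Analysis.FluidPDE.BeltramiFlows
import Literature.Analysis.FluidPDE.PeriodicGalileanNonuniqueness
import HarnessLib

/-!
# Claim skeleton: Geurdes (2017), «A type D breakdown of the Navier Stokes equation in d = 3
# spatial dimensions» (Cogent Mathematics 4 (2017) 1284293 ≡ arXiv:1703.05113v1)

Cell `ns-claims` (D-0090 NS-CLAIMS SWEEP), claim C106, typist `ns-claims-typist-3` (g2).
UNREFEREED/DISPUTED CLAIM under adjudication — NOTHING in this file asserts a step: every `Step…`
declaration is a `Prop` (the paper's load-bearing assertions, typed concretely so that `¬ Step` or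
its vacuity can be a kernel theorem, to be filed summit-side by a refuter as
`Theorems/SoloRefuteGeurdes2017.lean`); the only `theorem`s are the kernel composition
`claim_of_steps` (pure logic), its variants, and unfolding/bookkeeping lemmas.

Version of record (pinned by ns-claims-lit-1 g3, LOCATORS.md 2026-08-26T21:15Z): Han Geurdes,
Cogent Mathematics 4(1) (2017) Art. 1284293, doi:10.1080/23311835.2017.1284293 (open access) — the
arXiv e-print 1703.05113 v1 (physics.gen-ph, sole version, PDF-only) carries the IDENTICAL text
layer page by page (9 pp.), so locators are «p. N of 9» + equation numbers; bib key `Geurdes2017`.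
Page renders `pub/ns-claims/sources/Geurdes2017/renders/p003–p008.png` (displays are images).

## Claimed statement (as printed)

Abstract p.1: «In this paper a type D breakdown of the Navier Stokes (NS) in ℝ^d with d = 3, is
demonstrated. The element of the breakdown also occurs in the Euler equation.» §1.2 p.3 fixes the
target as Fefferman's (D), quoted: «Take ν > 0 (in (1.1)), and the space ℝ^d with d = 3. Then there
exists a smooth, divergence-free vector field u⁰(x) on ℝ³ and a smooth f(x,t) on ℝ³ × [0,∞),
satisfying (8), (9), i.e. (1.3) u⁰(x + eⱼ) = u⁰(x), f(x + eⱼ,t) = f(x,t) and (1.4)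
|∂ₓ^α ∂ₜ^m f(x,t)| ≤ C_{α,m,K}(1 + |t|)^{−K}, for which there exist no solutions (p,u) of (1), (2),
(3), (10), (11) on ℝ³ × [0,∞)». §3 p.8: «There is a type D breakdown in d = 3»; p.9: «For valid
(u⁰, f) there is no (p,u) possible that exactly solves the NS.» Typed: `ClaimedTheorem` = the
printed (D) over the paper's own classes 𝒰 (2.1) and 𝒢 (2.2) — PROVED equal to the schema
statement `ClayVariants.clayPeriodic.Breakdown` (`claimed_iff_clayD`) and hence to the conjecture
leaf `NavierStokesBreakdownPeriodic` (`clayD_of_claimed`); the Euler sentence is `ClaimedEuler`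
(= `clayPeriodic.BreakdownAt 0`, not a Clay statement, Δ2).

## Clay delta (reference `ClayVariants.lean`)

Nearest: printed (D). Δ1 DOMAIN: «ℝ^d, d = 3» but the periodic items (8)–(11) are quoted and used
(𝒰, 𝒢 periodic) ⇒ the (D) schema on ℝ³ with ℤ³-periodic fields — «=». Δ3 FORCE: the paper's class
𝒢 (2.2) IS Fefferman's (8) ∧ (9) INCLUDING the time decay (1.4) («K ∈ ℝ» arbitrary ⇒ all K : ℕ;
typed by `HasRapidTimeDecay`) — «=»; that the paper's STATIONARY witness force f^crl (2.18) belongs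
to 𝒢 is therefore an on-path STEP (`Step3_fcrlInG`, justified in print by `Step3a_stationaryCriterion`
«condition (9) for stationary force … is (2.19); the constant K is no longer of importance», p.6),
not a delta. Δ4 DATA: witness class 𝒰″ ⊂ 𝒰 (§2.6: non-constant, not a gradient, ∇×∇×u⁰ ≢ 0,
bounded derivatives (2.20)) — a subclass offered as witness class of an ∃-statement: «=». Δ5/Δ6
REGULARITY READING: the paper writes C^N, «N ∈ ℕ … 1 < N ∼ large … untraceable large and growing
if necessary, but finite» (p.2–3, p.8) for Fefferman's C^∞ (11); every step below is uniform in the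
regularity index, the objects the construction names may all be taken C^∞, and the two candidate
failing steps do not depend on it (a stationary force decays for no N; the eigenspace countermodel
named under Step 6 is C^∞) — typed C^∞ (the reading under which the text addresses (D) at all); a
finite-N companion is appended on a referee's request. Δ7: «Take ν > 0» as printed (∀ ν), immaterial
by `ClayVariants.clayPeriodic_breakdownAt_iff`; ν = 0 (§2.7) is the separate `ClaimedEuler`. Δ8
NEGATION (the load-bearing axis): (D) needs «NO (p,u) satisfies (1),(2),(3),(10),(11)»; §2.3 shows
that ONE ansatz family v^h (2.4) violates (3), (2), (10) — presented «as required in a type D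
breakdown» (`Step1_vhViolates`, TRUE statements) —, §2.4–§2.6 that v^h admits no pressure at t = h
(`Step5_noPressure`, TRUE), and §2.8/§3 carry this to all (p,u) by ONE sentence, p.8: «If no v^h can
be found then no u can be found either. Therefore, it is sufficient to only look at the D breakdown
yes-or-no possibility of v^h» — typed as `Step6_vhSufficiency` (as reasoned: for every u⁰ ∈ 𝒰″)
with the maximal-charity ∃-weakening `Step6E_vhSufficiencyExists` (what (D) minimally needs from it).

## Steps, in dependency order (paper item · page · typist's private flag)

* Step 1 = `Step1_vhViolates` — §2.3 (2.5)–(2.8) p.4–5: v^h(·,0) ≠ u⁰, ∇·v^h|_{t=h} = 3, v^h not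
  periodic («Equation (2)/(3)/(10) of Fefferman breaks down … as required in a type D breakdown»)
  — true computations; NOT consumed by the kernel route (context: the Δ8 reading).
* Step 2 = `Step2_operatorAtH` — §2.4 (2.9)–(2.16), (2.17) p.5–6: 𝒩(v^h)|_{t=h} = (c + x) +
  𝒟_{c,ν}u⁰, 𝒟_{c,ν} ≡ 1 + c·∇ − ν∇² — true (calculus); printed support of Step 5 (with Step 5a).
* Step 3a = `Step3a_stationaryCriterion` — §2.5 p.6, sentence after (2.18) with (2.19): «condition
  (9) of Fefferman for stationary force, suppressing the notation of the t = 0 in the function, is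
  |∂ₓ^α f(x)| ≤ C_{α,0,K} (2.19). The constant K is no longer of importance to the upper limit» —
  typed at the abstract grain (HYGIENE 13): a smooth periodic STATIONARY field with bounded
  derivatives of all orders is in 𝒢 — known-false pattern (a non-zero stationary force has no
  (1+t)^{−K} decay, K ≥ 1).
* Step 3b = `Step3b_fcrlRegular` — §2.6 (2.20) p.6 («the function u⁰ must be bounded (2.20) in
  order to satisfy f^crl ∈ 𝒢 i.e. its equivalent in (2.19)»): for u⁰ ∈ 𝒰″ the slice f^crl is
  smooth, periodic, with bounded derivatives — true.
* Step 3 = `Step3_fcrlInG` — §2.5 (2.18) p.6 «f^crl(x,t) = f^crl(x,0) = ∇×u⁰(x) + 𝒟_{c,ν}u⁰(x) …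
  and is in 𝒢, see (2.2)»; ON-PATH; `step3_of_step3a_step3b` PROVED (so a kill of 3a is a kill of
  the printed justification; the refuter states whether f^crl ∈ 𝒢 itself fails — it does whenever
  f^crl ≢ 0).
* Step 4 = `Step4_subclassNonempty` — §2.6 p.6 «the definition of 𝒰 is such that we are able to
  have a non empty subset 𝒰″» — true (e.g. the 1-periodic ABC/Beltrami field; tree:
  `Literature.Analysis.FluidPDE.abc`, `curl_abc`, after rescaling x ↦ 2πx).
* Step 5a = `Step5a_noGradient` — (2.22)–(2.23) p.7: no C² scalar q has ∇q = ∇×u⁰ − (c + x) when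
  ∇×∇×u⁰ ≢ 0 («curl on grad results … into the zero vector … while … ∇×∇×u⁰ is not the zero
  vector») — true (tree: `curl_gradient_eq_zero_holds`).
* Step 5 = `Step5_noPressure` — p.7 «with f^crl ∈ 𝒢 and u⁰ ∈ 𝒰″ it is possible to define a
  function v^h in (2.4) … with arbitrary h ∈ [0,∞) such that it is impossible to find a p = p(x,t)
  function. Hence it is not possible to find (p, v^h) that solves the NS Equation (1.1)»: the
  momentum equation (1) for (v^h, p, f^crl) at t = h has no smooth pressure — true (from Steps 2,
  5a); ON-PATH (it is the antecedent of Step 6).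
* Step 6 = `Step6_vhSufficiency` — §2.8 (2.24)–(2.25) p.7 + §3 ¶1 p.8 «conclusions for v^h have
  their impact on u. If no v^h can be found then no u can be found either. Therefore, it is
  sufficient to only look at the D breakdown yes-or-no possibility of v^h defined in (2.3) and
  (2.4)» — typed as reasoned (for every ν ≥ 0, c ≠ 0, u⁰ ∈ 𝒰″): Step 5's non-solvability of v^h
  ⇒ the Cauchy problem (u⁰, f^crl) has NO smooth solution with periodic velocity — suspicious /
  known-false pattern: for a strong Beltrami datum u⁰ ∈ E_λ (∇×u⁰ = λu⁰, e.g. rescaled ABC, which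
  lies in 𝒰″) the paper's force f^crl = (λ + 1 + νλ²)u⁰ + (c·∇)u⁰ lies in the translation-invariant
  eigenspace E_λ, on which (u·∇)u = ∇(|u|²/2) (tree: `IsBeltrami.convect_eq_gradient`,
  `laplacian_eq_of_strongBeltrami`), so u(t) = e^{−νλ²t}u⁰ + ((1 − e^{−νλ²t})/(νλ²)) f^crl (ν > 0;
  u⁰ + t f^crl at ν = 0), p = −|u|²/2 is an explicit GLOBAL smooth solution with periodic u AND p.
  `Step6E_vhSufficiencyExists` = the ∃-weakening (some c ≠ 0, u⁰ ∈ 𝒰″ per ν) — open-strength as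
  far as this typist knows (a (D)-type statement for the non-decaying force family f^crl).
* The «global function» (2.25) u(x,t) = lim_{δ→0} Σ_λ χ_λ(t) v^{inf λ}(x,t) is `compoundU`; since
  ξ^t(x,t) = x it is the STATIONARY field c + x + u⁰(x) (`compoundU_eq`, PROVED), of divergence 3.
Not typed as steps: §2.7 (Euler: same chain at ν = 0 — covered by the `0 ≤ ν` quantifiers and
`claimEuler_of_steps`), §3 ¶2–¶5 p.8 (d = 2 «home made curl», anyons), p.8–9 (constructive-analysis
remarks on N).

## COMPOSITION — PROVED

`claim_of_steps : Step1 → Step2 → Step3a → Step3b → Step4 → Step5a → Step5 → Step6 → ClaimedTheorem`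
(consumes 3a, 3b, 4, 5, 6; pure logic: u⁰ from Step 4, any c ≠ 0, f := f^crl ∈ 𝒢 by Step 3, no
solution by Step 6 fed with Step 5); `claim_of_stepsE` (3a, 3b, 5, 6E); `claimEuler_of_steps` (same
at ν = 0); `clayD_of_claimed : ClaimedTheorem → NavierStokesBreakdownPeriodic` (the claim as typed IS
printed (D): an ALL-STEPS-RESIST outcome would be an escalation, not a wrong-problem row).

WHAT THIS IS NOT: not a claim about NS regularity or blow-up; not a claim about any author beyond the
typed locator.
-/

open Set
open scoped RealInnerProductSpace ContDiff Laplacian Topology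

namespace Literature.Claims.NS.Geurdes2017

open Literature.Analysis.FluidPDE

noncomputable section

/-! ## Vocabulary of the construction (definitions with bodies; nothing asserted) -/

/-- (2.3) p.4: `ξ^h(x,t) = x − (t − h)(x + u⁰(x))`, for `h ∈ [0,∞)`; `ξ^h(x,h) = x`.
[cite: Geurdes2017, eq. (2.3) p.4] -/
def xi (u0 : EuclideanSpace ℝ (Fin 3) → EuclideanSpace ℝ (Fin 3)) (h t : ℝ)
    (x : EuclideanSpace ℝ (Fin 3)) : EuclideanSpace ℝ (Fin 3) :=
  x - (t - h) • (x + u0 x)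

/-- (2.4) p.4: the ansatz velocity `v^h(x,t) = c + x + u⁰(ξ^h(x,t))`, «c a constant vector (c ≠ 0)».
Arguments: datum `u0`, constant `c`, label `h`, time `t`, point `x`. [cite: Geurdes2017, eq. (2.4) p.4] -/
def vh (u0 : EuclideanSpace ℝ (Fin 3) → EuclideanSpace ℝ (Fin 3)) (c : EuclideanSpace ℝ (Fin 3))
    (h t : ℝ) (x : EuclideanSpace ℝ (Fin 3)) : EuclideanSpace ℝ (Fin 3) :=
  c + x + u0 (xi u0 h t x)

/-- `𝒟_{c,ν} ≡ 1 + c·∇ − ν∇²` applied to `u⁰` at `x` ((2.17) p.6): `u⁰(x) + (c·∇)u⁰(x) − νΔu⁰(x)`,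
with `(c·∇)u⁰(x) = Du⁰(x)c`. [cite: Geurdes2017, eq. (2.17) p.6] -/
def dOp (c : EuclideanSpace ℝ (Fin 3)) (ν : ℝ)
    (u0 : EuclideanSpace ℝ (Fin 3) → EuclideanSpace ℝ (Fin 3)) (x : EuclideanSpace ℝ (Fin 3)) :
    EuclideanSpace ℝ (Fin 3) :=
  u0 x + fderiv ℝ u0 x c - ν • (Δ u0) x

/-- (2.18) p.6: the STATIONARY witness force `f^crl(x,t) = f^crl(x,0) = ∇×u⁰(x) + 𝒟_{c,ν}u⁰(x)`,
as a space-time field constant in `t`. [cite: Geurdes2017, eq. (2.18) p.6] -/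
def fcrl (ν : ℝ) (c : EuclideanSpace ℝ (Fin 3))
    (u0 : EuclideanSpace ℝ (Fin 3) → EuclideanSpace ℝ (Fin 3)) :
    ℝ → EuclideanSpace ℝ (Fin 3) → EuclideanSpace ℝ (Fin 3) :=
  fun _ x => curl u0 x + dOp c ν u0 x

/-- The class 𝒰 (2.1) p.3: `{u⁰ | ∇·u⁰ = 0, u⁰(x + eⱼ) = u⁰(x), u⁰ₖ ∈ C^N(ℝ³)}` — Fefferman's
smooth divergence-free periodic data (8); C^N typed C^∞ (module docstring, Δ5/Δ6 reading).
[cite: Geurdes2017, eq. (2.1) p.3] -/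
def dataClass (u0 : EuclideanSpace ℝ (Fin 3) → EuclideanSpace ℝ (Fin 3)) : Prop :=
  ContDiff ℝ ∞ u0 ∧ NSWave0.IsDivFree u0 ∧ IsLatticePeriodic u0

/-- The class 𝒢 (2.2) p.3: `{f | fₖ ∈ C^N, f(x + eⱼ,t) = f(x,t), |∂ₓ^α ∂ₜ^m f(x,t)| ≤
C_{α,m,K}(1 + |t|)^{−K}}` «where we must see arbitrary α ∈ ℕ³, m ∈ ℕ, both finite, and K ∈ ℝ» —
Fefferman's (8) ∧ (9) for a force smooth on `ℝ³ × [0,∞)`; the decay clause is the tree's (9)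
predicate `HasRapidTimeDecay` (all derivative orders, all `K : ℕ` — equivalent to «K ∈ ℝ arbitrary»,
`(1+t)^{−K}` being monotone in `K`); periodicity asked for `t ≥ 0`, where `f` lives. This is
literally the force slot of `ClayVariants.clayPeriodic`. [cite: Geurdes2017, eq. (2.2) p.3] -/
def forceClass (f : ℝ → EuclideanSpace ℝ (Fin 3) → EuclideanSpace ℝ (Fin 3)) : Prop :=
  IsSmoothOnHalfSpace f ∧ (∀ t : ℝ, 0 ≤ t → IsLatticePeriodic (f t)) ∧ HasRapidTimeDecay f

/-- The witness class 𝒰″ ⊂ 𝒰, §2.6 p.6: `u⁰ ∈ 𝒰` and «u⁰ is not a vector function of absolute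
constants», «u⁰ is not a gradient vector of an arbitrary proper function φ(x)», «∇×∇×u⁰ ≢ 0», and
«a fourth point … the function u⁰ must be bounded (2.20) |∂ₓ^{α_u} u⁰(x)| ≤ C_{α_u}» (all orders).
[cite: Geurdes2017, §2.6 with eq. (2.20) p.6] -/
def dataSubclass (u0 : EuclideanSpace ℝ (Fin 3) → EuclideanSpace ℝ (Fin 3)) : Prop :=
  dataClass u0 ∧
    (¬ ∃ a : EuclideanSpace ℝ (Fin 3), ∀ x, u0 x = a) ∧
    (¬ ∃ φ : EuclideanSpace ℝ (Fin 3) → ℝ, Differentiable ℝ φ ∧ ∀ x, u0 x = gradient φ x) ∧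
    (∃ x, curl (curl u0) x ≠ 0) ∧
    (∀ n : ℕ, ∃ C : ℝ, ∀ x, ‖iteratedFDeriv ℝ n u0 x‖ ≤ C)

/-- The momentum equation (1.1) for the pair `(v^h, p)` with force `f^crl` AT THE TIME `t = h`
(time derivative within `[0,∞)`, exactly the `momentum` field of `IsNavierStokesSolution`):
`∂ₜv^h + (v^h·∇)v^h = νΔv^h − ∇p + f^crl` at `(h, x)` for every `x`. This is what «(p, v^h) solves
the NS Equation (1.1)» is used for on p.7 (the argument only ever evaluates at `t = h`, (2.12)–(2.17)).
[cite: Geurdes2017, eq. (1.1) p.3 with (2.16)–(2.17) p.5–6] -/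
def vhSolvesMomentumAt (ν : ℝ) (c : EuclideanSpace ℝ (Fin 3))
    (u0 : EuclideanSpace ℝ (Fin 3) → EuclideanSpace ℝ (Fin 3)) (h : ℝ)
    (p : ℝ → EuclideanSpace ℝ (Fin 3) → ℝ) : Prop :=
  ∀ x, derivWithin (fun s => vh u0 c h s x) (Ici 0) h + fderiv ℝ (vh u0 c h h) x (vh u0 c h h x) =
    ν • (Δ (vh u0 c h h)) x - gradient (p h) x + fcrl ν c u0 h x

/-- (2.25) p.7: the «global function» `u(x,t) = lim_{0<δ→0} Σ_{λ∈Λ} χ_λ(t) v^{inf(λ)}(x,t)` over the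
partition `Λ` (2.24) of `[0,∞)` into intervals `[h, h+δ)`: for `t ∈ λ = [h, h+δ)` the sum is
`v^h(x,t)` with `h = inf λ → t` as `δ → 0`, i.e. the limit is `v^t(x,t)` («an increasingly better …
approximation of the possibility that u(x,t) = v^h(x,t) and t in [h, h+δ)», p.8).
[cite: Geurdes2017, eqs. (2.24)–(2.25) p.7 and §3 ¶1 p.8] -/
def compoundU (u0 : EuclideanSpace ℝ (Fin 3) → EuclideanSpace ℝ (Fin 3)) (c : EuclideanSpace ℝ (Fin 3))
    (t : ℝ) (x : EuclideanSpace ℝ (Fin 3)) : EuclideanSpace ℝ (Fin 3) :=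
  vh u0 c t t x

/-- `ξ^h(x,h) = x` (p.4, «For t = h, we have, ξ^h(x,h) = x»). [cite: Geurdes2017, eq. (2.3) p.4] -/
@[simp] theorem xi_self (u0 : EuclideanSpace ℝ (Fin 3) → EuclideanSpace ℝ (Fin 3)) (h : ℝ)
    (x : EuclideanSpace ℝ (Fin 3)) : xi u0 h h x = x := by
  simp [xi]

/-- `v^h(x,h) = c + x + u⁰(x)` (p.4). [cite: Geurdes2017, eq. (2.4) p.4] -/
@[simp] theorem vh_self (u0 : EuclideanSpace ℝ (Fin 3) → EuclideanSpace ℝ (Fin 3))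
    (c : EuclideanSpace ℝ (Fin 3)) (h : ℝ) (x : EuclideanSpace ℝ (Fin 3)) :
    vh u0 c h h x = c + x + u0 x := by
  simp [vh]

/-- **The compound «global function» (2.25) is the STATIONARY field `c + x + u⁰(x)`** (so it has
divergence 3 and never equals `u⁰` at `t = 0`): `u(x,t) = v^t(x,t) = c + x + u⁰(ξ^t(x,t)) = c + x +
u⁰(x)`. [cite: Geurdes2017, eq. (2.25) p.7 and §3 ¶1 p.8] -/
theorem compoundU_eq (u0 : EuclideanSpace ℝ (Fin 3) → EuclideanSpace ℝ (Fin 3))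
    (c : EuclideanSpace ℝ (Fin 3)) (t : ℝ) (x : EuclideanSpace ℝ (Fin 3)) :
    compoundU u0 c t x = c + x + u0 x := by
  simp [compoundU]

/-- `f^crl` is stationary (unfolding). [cite: Geurdes2017, eq. (2.18) p.6] -/
theorem fcrl_apply (ν : ℝ) (c : EuclideanSpace ℝ (Fin 3))
    (u0 : EuclideanSpace ℝ (Fin 3) → EuclideanSpace ℝ (Fin 3)) (t : ℝ) (x : EuclideanSpace ℝ (Fin 3)) :
    fcrl ν c u0 t x = curl u0 x + (u0 x + fderiv ℝ u0 x c - ν • (Δ u0) x) := rfl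

/-! ## The claimed statement -/

/-- **The claim = Fefferman's (D) as quoted on p.3, over the paper's classes 𝒰 (2.1), 𝒢 (2.2)**:
«Take ν > 0 … Then there exists a smooth, divergence-free vector field u⁰(x) on ℝ³ and a smooth
f(x,t) on ℝ³ × [0,∞), satisfying (8), (9), for which there exist no solutions (p,u) of (1), (2),
(3), (10), (11) on ℝ³ × [0,∞)» («In the present paper we will see that one can select (u⁰, f) such
that it is not possible to find a (p,u) in d = 3», p.3; «There is a type D breakdown in d = 3», p.8).
«No solutions (p,u) of (1),(2),(3),(10),(11)» = `¬ clayPeriodic.Solvable ν f u⁰` (smooth `u`, `p`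
on the half-space, NS with datum `u⁰` and force `f`, `u(·,t)` periodic for `t ≥ 0` — pressure free,
as printed). [cite: Geurdes2017, §1.2 p.3 and §3 p.8] -/
def ClaimedTheorem : Prop :=
  ∀ ν : ℝ, 0 < ν →
    ∃ u0 : EuclideanSpace ℝ (Fin 3) → EuclideanSpace ℝ (Fin 3), dataClass u0 ∧
      ∃ f : ℝ → EuclideanSpace ℝ (Fin 3) → EuclideanSpace ℝ (Fin 3), forceClass f ∧
        ¬ ClayVariants.clayPeriodic.Solvable ν f u0

/-- **The Euler sentence** (abstract p.1 «The element of the breakdown also occurs in the Euler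
equation»; §2.7 p.7 «In the Euler equation there is no viscosity, i.e. ν = 0 … This leads us to the
same impossibility as presented in (2.23)»): the same breakdown statement at `ν = 0` — NOT a Clay
statement (Δ2). [cite: Geurdes2017, abstract p.1 and §2.7 p.7] -/
def ClaimedEuler : Prop :=
  ∃ u0 : EuclideanSpace ℝ (Fin 3) → EuclideanSpace ℝ (Fin 3), dataClass u0 ∧
    ∃ f : ℝ → EuclideanSpace ℝ (Fin 3) → EuclideanSpace ℝ (Fin 3), forceClass f ∧
      ¬ ClayVariants.clayPeriodic.Solvable 0 f u0

/-- **The claim as typed IS the schema statement «printed (D)»** (`clayPeriodic.Breakdown`): the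
classes 𝒰, 𝒢 are Fefferman's (8), (8) ∧ (9) verbatim. [cite: Geurdes2017, §1.2 p.3] -/
theorem claimed_iff_clayD : ClaimedTheorem ↔ ClayVariants.clayPeriodic.Breakdown := by
  refine forall₂_congr fun ν _ => ⟨?_, ?_⟩
  · rintro ⟨u0, ⟨hs, hd, hp⟩, f, ⟨hf, hfp, hfd⟩, hno⟩
    exact ⟨u0, f, hs, hd, hp, hf, ⟨hfp, hfd⟩, hno⟩
  · rintro ⟨u0, f, hs, hd, hp, hf, ⟨hfp, hfd⟩, hno⟩
    exact ⟨u0, ⟨hs, hd, hp⟩, f, ⟨hf, hfp, hfd⟩, hno⟩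

/-- **Clay link (HYGIENE 10(a))**: the claimed statement, as typed, implies — indeed is — the
conjecture leaf `NavierStokesBreakdownPeriodic` (printed (D)). [cite: Geurdes2017, §1.2 p.3] -/
theorem clayD_of_claimed (h : ClaimedTheorem) :
    Summit.NavierStokesRegularity.NavierStokesRegularity.NavierStokesBreakdownPeriodic :=
  ClayVariants.clayPeriodic_breakdown_iff.mp (claimed_iff_clayD.mp h)

/-- The Euler sentence is the schema's breakdown at `ν = 0` (bookkeeping; not a Clay statement).
[cite: Geurdes2017, §2.7 p.7] -/
theorem claimedEuler_iff : ClaimedEuler ↔ ClayVariants.clayPeriodic.BreakdownAt 0 := by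
  refine ⟨?_, ?_⟩
  · rintro ⟨u0, ⟨hs, hd, hp⟩, f, ⟨hf, hfp, hfd⟩, hno⟩
    exact ⟨u0, f, hs, hd, hp, hf, ⟨hfp, hfd⟩, hno⟩
  · rintro ⟨u0, f, hs, hd, hp, hf, ⟨hfp, hfd⟩, hno⟩
    exact ⟨u0, ⟨hs, hd, hp⟩, f, ⟨hf, hfp, hfd⟩, hno⟩

/-! ## The steps -/

/-- **Step 1 — §2.3 «Requirements (2) (3) and (10)», (2.5)–(2.8) p.4–5** (context; NOT consumed by
`claim_of_steps`): for `u⁰ ∈ 𝒰`, `c ≠ 0`, `h ≥ 0`: «we don't have Fefferman's u(x,0) = u⁰(x),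
because … v^h(x,0) = c + x + u⁰(ξ^h(x,0))» (2.5); «∇·v^h(x,t)|_{t=h} = ∇·x + ∇·u⁰(x) = 3 ≠ 0 … in
our case, Equation (2) of Fefferman breaks down» (2.6); «eⱼ shifts do not hold for v^h … we don't
have Fefferman's u(x,t) = u(x + eⱼ,t) for our v^h» (2.7)–(2.8) — each «as required in a type D
breakdown». Typed as the three facts (the last as the failure of (10), i.e. of periodicity at all
`t ≥ 0`). Typist's flag: true (the misreading lies in «as required», not in the computations).
[cite: Geurdes2017, §2.3 eqs. (2.5)–(2.8) p.4–5] -/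
def Step1_vhViolates : Prop :=
  ∀ u0 : EuclideanSpace ℝ (Fin 3) → EuclideanSpace ℝ (Fin 3), dataClass u0 →
    ∀ c : EuclideanSpace ℝ (Fin 3), c ≠ 0 → ∀ h : ℝ, 0 ≤ h →
      vh u0 c h 0 ≠ u0 ∧
      (∀ x, NSWave0.divergence (vh u0 c h h) x = 3) ∧
      ¬ (∀ t : ℝ, 0 ≤ t → IsLatticePeriodic (vh u0 c h t))

/-- **Step 2 — §2.4 «Differentiation to match terms in 𝒩», (2.9)–(2.16) p.5 and (2.17) p.6**:
«The three results (2.12), (2.14) and (2.15) then give, for t = h, h ∈ [0,∞),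
𝒩_{v^h}(v^h(x,t))|_{t=h} = −((x + u⁰(x))·∇)u⁰(x) + (c + x + u⁰(x)) + ((c + x + u⁰(x))·∇)u⁰(x) −
ν∇²u⁰(x)», i.e. `(c + x) + 𝒟_{c,ν}u⁰(x)` (2.17). Typed with the one-sided time derivative within
`[0,∞)` (as in `IsNavierStokesSolution`). Typist's flag: true (chain rule at `t = h`, where
`ξ^h = x`, `∂ₜξ^h = −(x + u⁰)`, `Dξ^h = id`, `D²ξ^h = 0`). [cite: Geurdes2017, eqs. (2.12)–(2.17) p.5–6] -/
def Step2_operatorAtH : Prop :=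
  ∀ ν : ℝ, ∀ u0 : EuclideanSpace ℝ (Fin 3) → EuclideanSpace ℝ (Fin 3), dataClass u0 →
    ∀ c : EuclideanSpace ℝ (Fin 3), ∀ h : ℝ, 0 ≤ h → ∀ x,
      derivWithin (fun s => vh u0 c h s x) (Ici 0) h + fderiv ℝ (vh u0 c h h) x (vh u0 c h h x) -
          ν • (Δ (vh u0 c h h)) x =
        (c + x) + dOp c ν u0 x

/-- **Step 3a — §2.5 p.6, the sentence after (2.18) with (2.19) (abstract grain, HYGIENE 13)**: «Note
also that condition (9) of Fefferman (2000) for stationary force, suppressing the notation of the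
t = 0 in the function, is |∂ₓ^α f^crl(x)| ≤ C_{α,0,K} (2.19). The constant K is no longer of
importance to the upper limit in (2.19). … If t = 0, then substituting this on both sides of the
inequality … we find is |∂ₓ^α f^crl(x)| ≤ C_{α,0}.» Typed as the inference the text draws: a
STATIONARY force whose slice is smooth, periodic and has bounded derivatives of every order
((2.19)) belongs to 𝒢 (2.2). Typist's flag: known-false pattern ((2.2)/(9) quantify over all
`t ≥ 0` and all `K`: a stationary `f ≢ 0` violates `(1+t)^K‖f(x)‖ ≤ C` for `K = 1`).
[cite: Geurdes2017, §2.5 eq. (2.19) p.6] -/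
def Step3a_stationaryCriterion : Prop :=
  ∀ g : EuclideanSpace ℝ (Fin 3) → EuclideanSpace ℝ (Fin 3), ContDiff ℝ ∞ g → IsLatticePeriodic g →
    (∀ n : ℕ, ∃ C : ℝ, ∀ x, ‖iteratedFDeriv ℝ n g x‖ ≤ C) →
      forceClass (fun _ : ℝ => g)

/-- **Step 3b — §2.6 (2.20) p.6**: «Looking at (2.18) and at (2.19), we may note that the function u⁰
must be bounded |∂ₓ^{α_u} u⁰(x)| ≤ C_{α_u} (2.20) in order to satisfy f^crl ∈ 𝒢 i.e. its equivalent
in (2.19) in combination with f^crl(x) = ∇×u⁰(x) + 𝒟_{c,ν}u⁰(x) of (2.18)» and «f^crl(x + eⱼ) =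
f^crl(x)»: for `u⁰ ∈ 𝒰″` the slice `f^crl` is smooth, ℤ³-periodic and satisfies (2.19). Typist's
flag: true (derivatives of a smooth periodic field are smooth, periodic, bounded).
[cite: Geurdes2017, §2.5–§2.6 eqs. (2.18)–(2.20) p.6] -/
def Step3b_fcrlRegular : Prop :=
  ∀ ν : ℝ, 0 ≤ ν → ∀ c : EuclideanSpace ℝ (Fin 3), c ≠ 0 →
    ∀ u0 : EuclideanSpace ℝ (Fin 3) → EuclideanSpace ℝ (Fin 3), dataSubclass u0 →
      ContDiff ℝ ∞ (fcrl ν c u0 0) ∧ IsLatticePeriodic (fcrl ν c u0 0) ∧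
        ∀ n : ℕ, ∃ C : ℝ, ∀ x, ‖iteratedFDeriv ℝ n (fcrl ν c u0 0) x‖ ≤ C

/-- **Step 3 — §2.5 «Selection of f, requirement (9)», (2.18) p.6, ON-PATH**: «If we note that f must
be in 𝒢, defined in (2.2), then we can select u⁰ from 𝒰 … such that a stationary f = f^crl is given
by f^crl(x,t) = f^crl(x,0) = ∇×u⁰(x) + 𝒟_{c,ν}u⁰(x) ≡ f^crl(x) (2.18) and is in 𝒢, see (2.2)»;
p.7: «Hence, with f^crl ∈ 𝒢 and u⁰ ∈ 𝒰″ …». Typed: for every `ν ≥ 0` (ν > 0 p.3; ν = 0 §2.7),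
`c ≠ 0`, `u⁰ ∈ 𝒰″`, the force `f^crl` is in 𝒢. Derived in print from Steps 3a + 3b
(`step3_of_step3a_step3b`). Typist's flag: suspicious (inherits 3a: a stationary non-zero force is
not in 𝒢). [cite: Geurdes2017, §2.5 eq. (2.18) p.6 and p.7 l.1 of ¶3] -/
def Step3_fcrlInG : Prop :=
  ∀ ν : ℝ, 0 ≤ ν → ∀ c : EuclideanSpace ℝ (Fin 3), c ≠ 0 →
    ∀ u0 : EuclideanSpace ℝ (Fin 3) → EuclideanSpace ℝ (Fin 3), dataSubclass u0 →
      forceClass (fcrl ν c u0)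

/-- **Step 4 — §2.6 p.6**: «Of course, the definition of 𝒰 is such that we are able to have a non
empty subset 𝒰″.» Typist's flag: true (witness: the 1-periodic ABC field `x ↦ abc A B C (2πx)`,
a strong Beltrami field with `∇×∇×u⁰ = 4π²u⁰ ≠ 0`; tree `Literature.Analysis.FluidPDE.abc`,
`curl_abc`, `isDivFree_abc`, `contDiff_abc`). [cite: Geurdes2017, §2.6 p.6] -/
def Step4_subclassNonempty : Prop :=
  ∃ u0 : EuclideanSpace ℝ (Fin 3) → EuclideanSpace ℝ (Fin 3), dataSubclass u0

/-- **Step 5a — (2.22)–(2.23) p.7 (abstract grain, HYGIENE 13)**: «it follows that for arbitrary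
h ∈ [0,∞) and c an absolute constant vector, ∇p(x,h) = ∇×u⁰(x) − (c + x) (2.22). Hence, it suffices
to inspect p(x,h) = p(x). We note that ∇×c = ∇×x = 0. Hence, ∇×∇p(x) = ∇×∇×u⁰(x) (2.23). Because of
the use of C^N, 1 < N, functions, we are allowed to take the curl … because u⁰ ∈ 𝒰″, Equation
(2.23) cannot be fulfilled … curl on grad results for all p into the zero vector … while … ∇×∇×u⁰(x)
is not the zero vector by necessity.» Typed over a `C²` scalar `q` (the regularity used to take the
curl). Typist's flag: true (`curl_gradient_eq_zero_holds`). [cite: Geurdes2017, eqs. (2.22)–(2.23) p.7] -/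
def Step5a_noGradient : Prop :=
  ∀ u0 : EuclideanSpace ℝ (Fin 3) → EuclideanSpace ℝ (Fin 3), ContDiff ℝ ∞ u0 →
    (∃ x, curl (curl u0) x ≠ 0) → ∀ c : EuclideanSpace ℝ (Fin 3),
      ¬ ∃ q : EuclideanSpace ℝ (Fin 3) → ℝ, ContDiff ℝ 2 q ∧ ∀ x, gradient q x = curl u0 x - (c + x)

/-- **Step 5 — p.7 ¶3, ON-PATH (the antecedent of Step 6)**: «Hence, with f^crl ∈ 𝒢 and u⁰ ∈ 𝒰″ it
is possible to define a function v^h in (2.4), using a u⁰ from 𝒰″ with arbitrary h ∈ [0,∞) such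
that it is impossible to find a p = p(x,t) function. Hence it is not possible to find (p, v^h) that
solves the NS Equation (1.1) with a valid (u⁰, f^crl). This represents requirement (1) of Fefferman
(2000).» Typed: for every `ν ≥ 0`, `c ≠ 0`, `u⁰ ∈ 𝒰″`, `h ≥ 0` there is NO smooth pressure `p` on
the half-space with which `v^h` satisfies the momentum equation (1.1) (force `f^crl`) at `t = h`.
Printed support: Steps 2 + 5a. Typist's flag: true. [cite: Geurdes2017, p.7 ¶3 with eqs. (2.17), (2.22)–(2.23)] -/
def Step5_noPressure : Prop :=
  ∀ ν : ℝ, 0 ≤ ν → ∀ c : EuclideanSpace ℝ (Fin 3), c ≠ 0 →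
    ∀ u0 : EuclideanSpace ℝ (Fin 3) → EuclideanSpace ℝ (Fin 3), dataSubclass u0 →
      ∀ h : ℝ, 0 ≤ h →
        ¬ ∃ p : ℝ → EuclideanSpace ℝ (Fin 3) → ℝ, IsSmoothOnHalfSpace p ∧ vhSolvesMomentumAt ν c u0 h p

/-- **Step 6 — §2.8 «Compound form» (2.24)–(2.25) p.7 + §3 ¶1 p.8, ON-PATH (the quantifier
passage)**: «The definition of u in (2.25) is an increasingly better -and unstoppable- approximation
of the possibility that u(x,t) = v^h(x,t) and t in [h, h+δ). The analysis can be maintained because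
of the continuum between h and h + δ, with 0 < δ → 0. Hence, conclusions for v^h have their impact on
u. If no v^h can be found then no u can be found either. Therefore, it is sufficient to only look at
the D breakdown yes-or-no possibility of v^h defined in (2.3) and (2.4).» (and p.9: «For valid (u⁰,
f) there is no (p,u) possible that exactly solves the NS»). Typed AS REASONED — for every `ν ≥ 0`,
`c ≠ 0` and `u⁰ ∈ 𝒰″` (the argument is run for the generic «valid (u⁰, f^crl)»): if for no `h ≥ 0`
the ansatz `v^h` admits a pressure at `t = h` (Step 5), then the Cauchy problem with datum `u⁰` and
force `f^crl` has NO solution in the sense (1),(2),(3),(10),(11) (`¬ clayPeriodic.Solvable`).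
Typist's flag: known-false pattern (strong Beltrami data: `f^crl ∈` the curl-eigenspace, where NS is
linear — explicit global smooth periodic solution; module docstring). The ∃-weakening is
`Step6E_vhSufficiencyExists`. [cite: Geurdes2017, §2.8 eqs. (2.24)–(2.25) p.7 and §3 ¶1 p.8] -/
def Step6_vhSufficiency : Prop :=
  ∀ ν : ℝ, 0 ≤ ν → ∀ c : EuclideanSpace ℝ (Fin 3), c ≠ 0 →
    ∀ u0 : EuclideanSpace ℝ (Fin 3) → EuclideanSpace ℝ (Fin 3), dataSubclass u0 →
      (∀ h : ℝ, 0 ≤ h →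
          ¬ ∃ p : ℝ → EuclideanSpace ℝ (Fin 3) → ℝ, IsSmoothOnHalfSpace p ∧ vhSolvesMomentumAt ν c u0 h p) →
        ¬ ClayVariants.clayPeriodic.Solvable ν (fcrl ν c u0) u0

/-- **Step 6E — the maximal-charity ∃-weakening of Step 6** (what the (D) assembly minimally needs
from the sentence p.8 «If no v^h can be found then no u can be found either»): for every `ν ≥ 0`
SOME `c ≠ 0` and SOME `u⁰ ∈ 𝒰″` for which Step 5's non-solvability of `v^h` implies that the
Cauchy problem `(u⁰, f^crl)` has no smooth solution with periodic velocity. Open-strength as far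
as this file knows (a (D)-type assertion for the stationary, non-decaying force family `f^crl`); no
printed sentence singles out such a `u⁰`. [cite: Geurdes2017, §3 ¶1 p.8 and p.9 «For valid (u⁰, f)»] -/
def Step6E_vhSufficiencyExists : Prop :=
  ∀ ν : ℝ, 0 ≤ ν → ∃ c : EuclideanSpace ℝ (Fin 3), c ≠ 0 ∧
    ∃ u0 : EuclideanSpace ℝ (Fin 3) → EuclideanSpace ℝ (Fin 3), dataSubclass u0 ∧
      ((∀ h : ℝ, 0 ≤ h →
          ¬ ∃ p : ℝ → EuclideanSpace ℝ (Fin 3) → ℝ, IsSmoothOnHalfSpace p ∧ vhSolvesMomentumAt ν c u0 h p) →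
        ¬ ClayVariants.clayPeriodic.Solvable ν (fcrl ν c u0) u0)

/-! ## Glue and composition (pure logic — PROVED) -/

/-- The printed derivation of Step 3 from Steps 3a + 3b («(2.20) in order to satisfy f^crl ∈ 𝒢 i.e.
its equivalent in (2.19)»): `f^crl` is the stationary force with slice `f^crl(·,0)`.
[cite: Geurdes2017, §2.5–§2.6 eqs. (2.18)–(2.20) p.6] -/
theorem step3_of_step3a_step3b (h3a : Step3a_stationaryCriterion) (h3b : Step3b_fcrlRegular) :
    Step3_fcrlInG := by
  intro ν hν c hc u0 hu0
  obtain ⟨hs, hp, hb⟩ := h3b ν hν c hc u0 hu0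
  exact h3a (fcrl ν c u0 0) hs hp hb

/-- A fixed non-zero constant vector for the composition («c is a constant vector (c ≠ 0)», p.4):
`e₁`. [cite: Geurdes2017, eq. (2.4) p.4] -/
def cOne : EuclideanSpace ℝ (Fin 3) :=
  EuclideanSpace.single 0 1

/-- `e₁ ≠ 0`. [cite: Geurdes2017, eq. (2.4) p.4] -/
theorem cOne_ne_zero : cOne ≠ 0 := by
  intro h
  have h0 := congrArg (fun v : EuclideanSpace ℝ (Fin 3) => v 0) h
  simp [cOne] at h0

/-- **KERNEL COMPOSITION (the paper's logic composes): Step 1 → Step 2 → Step 3a → Step 3b →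
Step 4 → Step 5a → Step 5 → Step 6 → ClaimedTheorem.** Consumed: 3a, 3b (⇒ 3: `f^crl ∈ 𝒢`), 4
(a datum `u⁰ ∈ 𝒰″ ⊂ 𝒰`), 5 (no pressure for `v^h`), 6 (sufficiency); Steps 1, 2, 5a are the
printed context/support and are not needed by the term. For `ν > 0`: witness `(u⁰, f^crl)` with
`c = e₁`. [cite: Geurdes2017, §2–§3 pp.3–8] -/
theorem claim_of_steps :
    Step1_vhViolates → Step2_operatorAtH → Step3a_stationaryCriterion → Step3b_fcrlRegular →
      Step4_subclassNonempty → Step5a_noGradient → Step5_noPressure → Step6_vhSufficiency →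
        ClaimedTheorem := by
  intro _ _ h3a h3b h4 _ h5 h6 ν hν
  obtain ⟨u0, hu0⟩ := h4
  have h3 : Step3_fcrlInG := step3_of_step3a_step3b h3a h3b
  exact ⟨u0, hu0.1, fcrl ν cOne u0, h3 ν hν.le cOne cOne_ne_zero u0 hu0,
    h6 ν hν.le cOne cOne_ne_zero u0 hu0 (fun h hh => h5 ν hν.le cOne cOne_ne_zero u0 hu0 h hh)⟩

/-- **Composition through the ∃-weakening 6E** (Steps 3a, 3b, 5, 6E ⇒ claim): the charitable
route. [cite: Geurdes2017, §2–§3 pp.3–8] -/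
theorem claim_of_stepsE (h3a : Step3a_stationaryCriterion) (h3b : Step3b_fcrlRegular)
    (h5 : Step5_noPressure) (h6E : Step6E_vhSufficiencyExists) : ClaimedTheorem := by
  intro ν hν
  obtain ⟨c, hc, u0, hu0, himp⟩ := h6E ν hν.le
  have h3 : Step3_fcrlInG := step3_of_step3a_step3b h3a h3b
  exact ⟨u0, hu0.1, fcrl ν c u0, h3 ν hν.le c hc u0 hu0,
    himp (fun h hh => h5 ν hν.le c hc u0 hu0 h hh)⟩

/-- **The Euler sentence composes from the same steps at `ν = 0`** (§2.7: «we can also select, in a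
way similar to (2.18), using ν = 0, a f^crl(x) force vector function from 𝒢. This leads us to the
same impossibility as presented in (2.23)»). [cite: Geurdes2017, §2.7 p.7] -/
theorem claimEuler_of_steps (h3a : Step3a_stationaryCriterion) (h3b : Step3b_fcrlRegular)
    (h4 : Step4_subclassNonempty) (h5 : Step5_noPressure) (h6 : Step6_vhSufficiency) :
    ClaimedEuler := by
  obtain ⟨u0, hu0⟩ := h4
  have h3 : Step3_fcrlInG := step3_of_step3a_step3b h3a h3b
  exact ⟨u0, hu0.1, fcrl 0 cOne u0, h3 0 le_rfl cOne cOne_ne_zero u0 hu0,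
    h6 0 le_rfl cOne cOne_ne_zero u0 hu0 (fun h hh => h5 0 le_rfl cOne cOne_ne_zero u0 hu0 h hh)⟩

/-! ## In-file discharges of the support steps flagged «true» (D-0026 debt; statements unchanged)

Steps 2, 3b, 4, 5a, 5 are elementary calculus facts about the ansatz (2.3)–(2.4) and the force
(2.18); they are proved here for the GENERAL datum `u⁰ ∈ 𝒰` / `𝒰″` exactly as typed above (the
summit-side refutation file certifies them only for the ABC datum). Nothing below touches the
adjudicated locator `Step3a_stationaryCriterion` or any statement. -/

/-! ### Small calculus facts -/

/-- The curl of the affine field `y ↦ c + y` vanishes (`D(c + ·) = id` is symmetric).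
[cite: Geurdes2017, eq. (2.23) p.7 «∇×c = ∇×x = 0»] -/
private theorem curl_const_add_self (c x : EuclideanSpace ℝ (Fin 3)) :
    curl (fun y => c + y) x = 0 := by
  have hf : fderiv ℝ (fun y : EuclideanSpace ℝ (Fin 3) => c + y) x = ContinuousLinearMap.id ℝ _ :=
    ((hasFDerivAt_id x).const_add c).fderiv
  unfold curl
  ext i
  fin_cases i <;> simp [hf]

/-- The Laplacian of the affine field `y ↦ c + y` vanishes. [folklore] -/
private theorem laplacian_const_add_self (c x : EuclideanSpace ℝ (Fin 3)) :
    Δ (fun y : EuclideanSpace ℝ (Fin 3) => c + y) x = 0 := by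
  rw [InnerProductSpace.laplacian_eq_iteratedFDeriv_stdOrthonormalBasis]
  refine Finset.sum_eq_zero fun i _ => ?_
  have h1 : fderiv ℝ (fun y : EuclideanSpace ℝ (Fin 3) => c + y) =
      fun _ => ContinuousLinearMap.id ℝ _ :=
    funext fun y => ((hasFDerivAt_id y).const_add c).fderiv
  simp [iteratedFDeriv_two_apply, h1]

/-- A differentiable potential whose gradient is a smooth field is `C²`. [folklore] -/
private theorem contDiff_two_of_gradient_eq {v : EuclideanSpace ℝ (Fin 3) → EuclideanSpace ℝ (Fin 3)}
    (hv : ContDiff ℝ ∞ v) {φ : EuclideanSpace ℝ (Fin 3) → ℝ} (hφ : Differentiable ℝ φ)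
    (hvφ : ∀ x, v x = gradient φ x) : ContDiff ℝ 2 φ := by
  have hfd : ∀ x y, fderiv ℝ φ x y = ⟪v x, y⟫ := by
    intro x y
    rw [hvφ x, inner_gradient_left]
  have h1 : ContDiff ℝ 1 (fderiv ℝ φ) := by
    rw [contDiff_clm_apply_iff]
    intro y
    have e : (fun x => fderiv ℝ φ x y) = fun x => ⟪v x, y⟫ := funext fun x => hfd x y
    rw [e]
    exact (hv.of_le (by exact_mod_cast (le_top : (1 : ℕ∞) ≤ ⊤))).inner ℝ contDiff_const
  have h2 : ContDiff ℝ ((1 : WithTop ℕ∞) + 1) φ := by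
    rw [contDiff_succ_iff_fderiv]
    exact ⟨hφ, fun h => absurd h (by simp), h1⟩
  exact h2

/-- The Laplacian of a smooth field is smooth (`Δf(x) = Σᵢ D²f(x)(eᵢ,eᵢ)`). [folklore] -/
private theorem contDiff_laplacian_of_smooth {v : EuclideanSpace ℝ (Fin 3) → EuclideanSpace ℝ (Fin 3)}
    (hv : ContDiff ℝ ∞ v) : ContDiff ℝ ∞ (Δ v) := by
  rw [InnerProductSpace.laplacian_eq_iteratedFDeriv_stdOrthonormalBasis]
  refine ContDiff.sum fun i _ => ?_
  have h2 : ContDiff ℝ ∞ (iteratedFDeriv ℝ 2 v) :=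
    hv.iteratedFDeriv_right (m := ∞) (i := 2) (by norm_cast)
  exact (ContinuousMultilinearMap.apply ℝ (fun _ : Fin 2 => EuclideanSpace ℝ (Fin 3))
    (EuclideanSpace ℝ (Fin 3)) _).contDiff.comp h2

/-- Each derivative of a smooth `ℤ³`-periodic field is bounded (it is continuous and
`ℤ³`-periodic, `IsLatticePeriodic.exists_forall_norm_le`). [folklore] -/
private theorem iteratedFDeriv_bounded_of_periodic {F : Type*} [NormedAddCommGroup F]
    [NormedSpace ℝ F] {g : EuclideanSpace ℝ (Fin 3) → F} (hg : ContDiff ℝ ∞ g)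
    (hper : IsLatticePeriodic g) (n : ℕ) : ∃ C : ℝ, ∀ x, ‖iteratedFDeriv ℝ n g x‖ ≤ C := by
  have hp : IsLatticePeriodic (iteratedFDeriv ℝ n g) := by
    intro j x
    have h := iteratedFDeriv_comp_add_right (𝕜 := ℝ) (f := g) n (EuclideanSpace.single j 1) x
    rw [show (fun z => g (z + EuclideanSpace.single j 1)) = g from funext (hper j)] at h
    exact h.symm
  exact hp.exists_forall_norm_le (hg.continuous_iteratedFDeriv (by exact_mod_cast le_top))

/-! ### The ansatz at `t = h`: (2.9)–(2.16) -/

/-- `∂ₛ v^h(x,s)|_{s=h} = −Du⁰(x)(x + u⁰(x))` (one-sided derivative within `[0,∞)` at `h ≥ 0`;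
(2.9)–(2.10) p.5: `∂ₜξ^h = −(x + u⁰)`, `ξ^h(x,h) = x`). [cite: Geurdes2017, eqs. (2.9)–(2.10) p.5] -/
theorem derivWithin_vh {u0 : EuclideanSpace ℝ (Fin 3) → EuclideanSpace ℝ (Fin 3)}
    (hu : Differentiable ℝ u0) (c : EuclideanSpace ℝ (Fin 3)) {h : ℝ} (hh : 0 ≤ h)
    (x : EuclideanSpace ℝ (Fin 3)) :
    derivWithin (fun s => vh u0 c h s x) (Ici 0) h = -(fderiv ℝ u0 x (x + u0 x)) := by
  have hin : HasDerivAt (fun s : ℝ => x - (s - h) • (x + u0 x)) (-((1 : ℝ) • (x + u0 x))) h :=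
    (((hasDerivAt_id h).sub_const h).smul_const (x + u0 x)).const_sub x
  have hx : x - (h - h) • (x + u0 x) = x := by simp
  have hU' : HasFDerivAt u0 (fderiv ℝ u0 x) (x - (h - h) • (x + u0 x)) := by
    rw [hx]; exact (hu x).hasFDerivAt
  have hcomp : HasDerivAt (fun s => vh u0 c h s x) (fderiv ℝ u0 x (-((1 : ℝ) • (x + u0 x)))) h :=
    (hU'.comp_hasDerivAt h hin).const_add (c + x)
  rw [one_smul, map_neg] at hcomp
  exact hcomp.hasDerivWithinAt.derivWithin (uniqueDiffOn_Ici 0 h (mem_Ici.2 hh))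

/-- The slice `v^h(·,h) = c + · + u⁰` (2.5)/(2.11). [cite: Geurdes2017, eq. (2.11) p.5] -/
theorem vh_self_eq (u0 : EuclideanSpace ℝ (Fin 3) → EuclideanSpace ℝ (Fin 3))
    (c : EuclideanSpace ℝ (Fin 3)) (h : ℝ) :
    vh u0 c h h = (fun y : EuclideanSpace ℝ (Fin 3) => c + y) + u0 := by
  funext y; rw [vh_self]; rfl

/-- `D(v^h(·,h))(x) = id + Du⁰(x)` (2.13). [cite: Geurdes2017, eq. (2.13) p.5] -/
theorem fderiv_vh_self {u0 : EuclideanSpace ℝ (Fin 3) → EuclideanSpace ℝ (Fin 3)}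
    (hu : Differentiable ℝ u0) (c : EuclideanSpace ℝ (Fin 3)) (h : ℝ)
    (x : EuclideanSpace ℝ (Fin 3)) :
    fderiv ℝ (vh u0 c h h) x = ContinuousLinearMap.id ℝ _ + fderiv ℝ u0 x := by
  rw [vh_self_eq]
  exact (((hasFDerivAt_id x).const_add c).add (hu x).hasFDerivAt).fderiv

/-- `Δ(v^h(·,h))(x) = Δu⁰(x)` (2.15) («∇²x = 0»). [cite: Geurdes2017, eq. (2.15) p.5] -/
theorem laplacian_vh_self {u0 : EuclideanSpace ℝ (Fin 3) → EuclideanSpace ℝ (Fin 3)}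
    (hu : ContDiff ℝ 2 u0) (c : EuclideanSpace ℝ (Fin 3)) (h : ℝ)
    (x : EuclideanSpace ℝ (Fin 3)) :
    Δ (vh u0 c h h) x = Δ u0 x := by
  have ha : ContDiffAt ℝ 2 (fun y : EuclideanSpace ℝ (Fin 3) => c + y) x :=
    (contDiff_const.add contDiff_id).contDiffAt
  rw [vh_self_eq, ha.laplacian_add hu.contDiffAt, laplacian_const_add_self, zero_add]

/-- **Step 2 holds** ((2.12)–(2.17) p.5–6): at `t = h`,
`∂ₜv^h + (v^h·∇)v^h − ν∇²v^h = (c + x) + 𝒟_{c,ν}u⁰(x)` for every `u⁰ ∈ 𝒰`, `c`, `h ≥ 0`.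
[cite: Geurdes2017, eqs. (2.12)–(2.17) p.5–6] -/
theorem step2_holds : Step2_operatorAtH := by
  intro ν u0 hu0 c h hh x
  have hd : Differentiable ℝ u0 := hu0.1.differentiable (by simp)
  have h2 : ContDiff ℝ 2 u0 := contDiff_infty.1 hu0.1 2
  rw [derivWithin_vh hd c hh, fderiv_vh_self hd, laplacian_vh_self h2, vh_self]
  simp only [_root_.add_apply, ContinuousLinearMap.id_apply, map_add, dOp]
  abel

/-! ### Step 5a and Step 5: no pressure for `v^h` -/

/-- **Step 5a holds** ((2.22)–(2.23) p.7): if `∇×∇×u⁰(x₀) ≠ 0`, no `C²` scalar `q` has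
`∇q = ∇×u⁰ − (c + ·)` — the curl of a `C²` gradient vanishes (tree
`curl_gradient_eq_zero_holds`) while `∇×(∇×u⁰ − (c + ·)) = ∇×∇×u⁰`.
[cite: Geurdes2017, eqs. (2.22)–(2.23) p.7] -/
theorem step5a_holds : Step5a_noGradient := by
  rintro u0 hu ⟨x₀, hx₀⟩ c ⟨q, hq, hgrad⟩
  have h0 : curl (gradient q) x₀ = 0 := curl_gradient_eq_zero_holds q hq x₀
  have hfun : gradient q = fun y => curl u0 y - (c + y) := funext hgrad
  have hc1 : ContDiff ℝ 1 (curl u0) :=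
    contDiff_curl (n := 1) (hu.of_le (by exact_mod_cast (le_top : (1 + 1 : ℕ∞) ≤ ⊤)))
  have hf' : DifferentiableAt ℝ (curl u0) x₀ := (hc1.differentiable one_ne_zero) x₀
  have hg' : DifferentiableAt ℝ (fun y : EuclideanSpace ℝ (Fin 3) => c + y) x₀ :=
    differentiableAt_id.const_add _
  rw [hfun, curl_sub hf' hg', curl_const_add_self, sub_zero] at h0
  exact hx₀ h0

/-- With Step 2, the momentum equation (1.1) for `(v^h, p, f^crl)` at `t = h` forces
`∇p(·,h) = ∇×u⁰ − (c + ·)` ((2.21)–(2.22) p.7). [cite: Geurdes2017, eqs. (2.21)–(2.22) p.7] -/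
theorem gradient_eq_of_vhSolvesMomentumAt {ν : ℝ} {c : EuclideanSpace ℝ (Fin 3)}
    {u0 : EuclideanSpace ℝ (Fin 3) → EuclideanSpace ℝ (Fin 3)} (hu0 : dataClass u0) {h : ℝ}
    (hh : 0 ≤ h) {p : ℝ → EuclideanSpace ℝ (Fin 3) → ℝ} (hmom : vhSolvesMomentumAt ν c u0 h p)
    (x : EuclideanSpace ℝ (Fin 3)) : gradient (p h) x = curl u0 x - (c + x) := by
  have e := hmom x
  have h2 := step2_holds ν u0 hu0 c h hh x
  have hg : gradient (p h) x = ν • Δ (vh u0 c h h) x + fcrl ν c u0 h x -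
      (derivWithin (fun s => vh u0 c h s x) (Ici 0) h +
        fderiv ℝ (vh u0 c h h) x (vh u0 c h h x)) := by
    rw [e]; abel
  have h3 : derivWithin (fun s => vh u0 c h s x) (Ici 0) h +
      fderiv ℝ (vh u0 c h h) x (vh u0 c h h x) =
        (c + x) + dOp c ν u0 x + ν • Δ (vh u0 c h h) x := by
    rw [← h2]; abel
  rw [hg, h3, fcrl_apply]
  simp only [dOp]
  abel

/-- **Step 5 holds** (p.7 ¶3): for `ν ≥ 0`, `c ≠ 0`, `u⁰ ∈ 𝒰″`, `h ≥ 0` there is no smooth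
pressure on the half-space with which `v^h` satisfies (1.1) at `t = h` — its slice `p(·,h)` would
be a `C²` potential of `∇×u⁰ − (c + ·)`, excluded by Step 5a since `∇×∇×u⁰ ≢ 0` on 𝒰″.
[cite: Geurdes2017, p.7 ¶3 with eqs. (2.17), (2.22)–(2.23)] -/
theorem step5_holds : Step5_noPressure := by
  rintro ν _hν c _hc u0 hu0 h hh ⟨p, hp, hmom⟩
  have hp' : IsSmoothSpaceTimeOn (Ici 0) p := hp
  have hp2 : ContDiff ℝ 2 (p h) := contDiff_infty.1 (hp'.contDiff_slice (mem_Ici.2 hh)) 2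
  exact step5a_holds u0 hu0.1.1 hu0.2.2.2.1 c
    ⟨p h, hp2, gradient_eq_of_vhSolvesMomentumAt hu0.1 hh hmom⟩

/-! ### Step 3b: regularity of the slice `f^crl(·,0)` -/

/-- `∇×u⁰` is `ℤ³`-periodic for `ℤ³`-periodic `u⁰`. [folklore] -/
private theorem isLatticePeriodic_curl {u0 : EuclideanSpace ℝ (Fin 3) → EuclideanSpace ℝ (Fin 3)}
    (hper : IsLatticePeriodic u0) : IsLatticePeriodic (curl u0) := by
  intro j x
  rw [curl_eq_curlCLM, curl_eq_curlCLM, ← fderiv_comp_add_right,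
    show (fun z => u0 (z + EuclideanSpace.single j 1)) = u0 from funext (hper j)]

/-- `Du⁰` is `ℤ³`-periodic for `ℤ³`-periodic `u⁰`. [folklore] -/
private theorem fderiv_add_single_of_periodic
    {u0 : EuclideanSpace ℝ (Fin 3) → EuclideanSpace ℝ (Fin 3)} (hper : IsLatticePeriodic u0)
    (j : Fin 3) (x : EuclideanSpace ℝ (Fin 3)) :
    fderiv ℝ u0 (x + EuclideanSpace.single j 1) = fderiv ℝ u0 x := by
  rw [← fderiv_comp_add_right,
    show (fun z => u0 (z + EuclideanSpace.single j 1)) = u0 from funext (hper j)]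

/-- `Δu⁰` is `ℤ³`-periodic for `ℤ³`-periodic `u⁰`. [folklore] -/
private theorem isLatticePeriodic_laplacian
    {u0 : EuclideanSpace ℝ (Fin 3) → EuclideanSpace ℝ (Fin 3)} (hper : IsLatticePeriodic u0) :
    IsLatticePeriodic (Δ u0) := by
  intro j x
  rw [← laplacian_comp_add_right,
    show (fun z => u0 (z + EuclideanSpace.single j 1)) = u0 from funext (hper j)]

/-- The slice `f^crl(·,0) = ∇×u⁰ + u⁰ + (c·∇)u⁰ − νΔu⁰` is smooth and `ℤ³`-periodic for smooth
`ℤ³`-periodic `u⁰`. [cite: Geurdes2017, eqs. (2.18)–(2.20) p.6] -/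
theorem fcrl_slice_smooth_periodic (ν : ℝ) (c : EuclideanSpace ℝ (Fin 3))
    {u0 : EuclideanSpace ℝ (Fin 3) → EuclideanSpace ℝ (Fin 3)} (hs : ContDiff ℝ ∞ u0)
    (hper : IsLatticePeriodic u0) :
    ContDiff ℝ ∞ (fcrl ν c u0 0) ∧ IsLatticePeriodic (fcrl ν c u0 0) := by
  have hcurl : ContDiff ℝ ∞ (curl u0) :=
    contDiff_curl (n := ⊤) (hs.of_le (by exact_mod_cast (le_top : (⊤ + 1 : ℕ∞) ≤ ⊤)))
  have hD : ContDiff ℝ ∞ fun x => fderiv ℝ u0 x c :=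
    (hs.fderiv_right (m := ∞) (by norm_cast)).clm_apply contDiff_const
  have hΔ : ContDiff ℝ ∞ (Δ u0) := contDiff_laplacian_of_smooth hs
  refine ⟨?_, ?_⟩
  · have e : fcrl ν c u0 0 = fun x => curl u0 x + (u0 x + fderiv ℝ u0 x c - ν • (Δ u0) x) := rfl
    rw [e]
    exact hcurl.add ((hs.add hD).sub (hΔ.const_smul ν))
  · intro j x
    rw [fcrl_apply, fcrl_apply, isLatticePeriodic_curl hper j x, hper j x,
      fderiv_add_single_of_periodic hper j x, isLatticePeriodic_laplacian hper j x]

/-- **Step 3b holds** ((2.18)–(2.20) p.6): for `u⁰ ∈ 𝒰″` the slice `f^crl(·,0)` is smooth,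
`ℤ³`-periodic, with every derivative bounded. [cite: Geurdes2017, §2.5–§2.6 eqs. (2.18)–(2.20) p.6] -/
theorem step3b_holds : Step3b_fcrlRegular := by
  intro ν _hν c _hc u0 hu0
  obtain ⟨hs, hp⟩ := fcrl_slice_smooth_periodic ν c hu0.1.1 hu0.1.2.2
  exact ⟨hs, hp, iteratedFDeriv_bounded_of_periodic hs hp⟩

/-! ### Step 4: `𝒰″ ≠ ∅` -/

/-- A smooth, divergence-free, `ℤ³`-periodic STRONG BELTRAMI field (`∇×v = λv`, `λ ≠ 0`) that
does not vanish identically lies in 𝒰″: it is not constant and not a gradient (both would force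
`∇×v ≡ 0`), `∇×∇×v = λ²v ≢ 0`, and its derivatives are bounded by periodicity. [folklore] -/
private theorem dataSubclass_of_strongBeltrami
    {v : EuclideanSpace ℝ (Fin 3) → EuclideanSpace ℝ (Fin 3)} (hs : ContDiff ℝ ∞ v)
    (hdiv : NSWave0.IsDivFree v) (hper : IsLatticePeriodic v) {lam : ℝ} (hlam : lam ≠ 0)
    (hcurl : ∀ x, curl v x = lam • v x) {x₀ : EuclideanSpace ℝ (Fin 3)} (hx₀ : v x₀ ≠ 0) :
    dataSubclass v := by
  have hd : Differentiable ℝ v := hs.differentiable (by simp)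
  have hcx₀ : curl v x₀ ≠ 0 := by rw [hcurl]; exact smul_ne_zero hlam hx₀
  refine ⟨⟨hs, hdiv, hper⟩, ?_, ?_, ⟨x₀, ?_⟩, iteratedFDeriv_bounded_of_periodic hs hper⟩
  · rintro ⟨a, ha⟩
    have hfa : v = fun _ => a := funext ha
    have hf0 : fderiv ℝ v x₀ = 0 := by rw [hfa]; exact fderiv_const_apply a
    exact hcx₀ (curl_eq_zero_of_fderiv_eq_zero hf0)
  · rintro ⟨φ, hφ, hvφ⟩
    have h2 := contDiff_two_of_gradient_eq hs hφ hvφ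
    have hc : curl (gradient φ) x₀ = 0 := curl_gradient_eq_zero_holds φ h2 x₀
    rw [show gradient φ = v from funext fun x => (hvφ x).symm] at hc
    exact hcx₀ hc
  · rw [show curl v = fun x => lam • v x from funext hcurl, curl_const_smul (hd x₀), hcurl, smul_smul]
    exact smul_ne_zero (mul_ne_zero hlam hlam) hx₀

/-- **Step 4 holds** (§2.6 p.6, «we are able to have a non empty subset 𝒰″»): the `1`-periodic
ABC field `x ↦ abc 0 1 1 (2πx) = (cos 2πx₂, sin 2πx₁, sin 2πx₂ + cos 2πx₁)` is smooth,
divergence free, `ℤ³`-periodic and strong Beltrami with `λ = 2π` (tree `ABC.curl_abc`,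
`ABC.isDivFree_abc`), and equals `(1,0,1) ≠ 0` at the origin. [cite: Geurdes2017, §2.6 p.6] -/
theorem step4_holds : Step4_subclassNonempty := by
  refine ⟨fun x => ABC.abc 0 1 1 ((2 * Real.pi) • x), ?_⟩
  have hs : ContDiff ℝ ∞ fun x : EuclideanSpace ℝ (Fin 3) => ABC.abc 0 1 1 ((2 * Real.pi) • x) :=
    (ABC.contDiff_abc 0 1 1).comp (contDiff_const_smul _)
  have hfd : ∀ x : EuclideanSpace ℝ (Fin 3),
      fderiv ℝ (fun y : EuclideanSpace ℝ (Fin 3) => ABC.abc 0 1 1 ((2 * Real.pi) • y)) x =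
        (2 * Real.pi) • fderiv ℝ (ABC.abc 0 1 1) ((2 * Real.pi) • x) :=
    fun x => fderiv_comp_smul (2 * Real.pi)
  refine dataSubclass_of_strongBeltrami hs ?_ ?_ (lam := 2 * Real.pi) (by positivity) ?_
    (x₀ := 0) ?_
  · intro x
    have h := ABC.isDivFree_abc 0 1 1 ((2 * Real.pi) • x)
    unfold VectorCalculus.divergence at h
    unfold NSWave0.divergence
    rw [hfd, ContinuousLinearMap.toLinearMap_smul, map_smul, h, smul_zero]
  · intro j x
    ext i
    fin_cases j <;> fin_cases i <;>
      simp [ABC.abc, Real.sin_add_two_pi, Real.cos_add_two_pi]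
  · intro x
    rw [curl_eq_curlCLM, hfd, map_smul, ← curl_eq_curlCLM, ABC.curl_abc]
  · intro h
    have h0 := congrArg (fun v : EuclideanSpace ℝ (Fin 3) => v 0) h
    simp [ABC.abc] at h0

end

end Literature.Claims.NS.Geurdes2017

-- WHAT THIS IS NOT: not a claim about NS regularity or blow-up; not a claim about any author beyond the typed locator.
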